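import Summits.SmoothPoincare4.Statement
import Literature.Topology.FourManifolds.HomotopySpheres
import Literature.Geometry.Riemannian.IsotropicCurvature
import Literature.Geometry.Riemannian.ConformallyFlat
import Literature.Geometry.Lorentzian.LeviCivita

/-!
# Route PIC — assemblies (SmoothPoincare4)

Target: `Summits/SmoothPoincare4/Theorems/PIC/Assembly.lean`.

Two bookkeeping steps of route `SmoothPoincare4/PIC` (planner-SmoothPoincare4-Survey-0), both
sorry-free and using nothing beyond their quoted hypotheses:

* `pic_assembly` settles stmt-SmoothPoincare4-0474: the Hamilton–Chen–Tang–Zhu theorem in the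
  simply connected case (hypothesis `hH`; named fact `Literature.Geometry.Riemannian.hamilton_chen_tang_zhu` /
  `Literature.Geometry.Riemannian.hamilton_pic_sphere_four`; Hamilton 1997 Thm. 1.1, Chen–Tang–Zhu 2012 Thm. 1.1),
  simple connectivity of spaces homotopy equivalent to `S⁴` (hypothesis `hSC`; theorem
  `Literature.Topology.FourManifolds.simplyConnectedSpace_of_homotopyEquiv_sphere_four` from the fact
  `Literature.Topology.FourManifolds.simplyConnectedSpace_sphere_four`) and the route thesis (every homotopy 4-sphere carries a
  Riemannian metric of positive isotropic curvature, stmt-SmoothPoincare4-0473) imply that every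
  `S : Literature.HomotopySphere 4` is diffeomorphic to the round `S⁴` — the input of the checked
  reduction stmt-SmoothPoincare4-0441.
* `lcf_assembly` settles stmt-SmoothPoincare4-0477: the same glue for the flow-free branch, with
  Kuiper's theorem (hypothesis `hK`; fact `Literature.Geometry.Riemannian.kuiper` / `kuiper_conformallyFlat_sphere_four`;
  Kuiper 1949) and the locally-conformally-flat crux stmt-SmoothPoincare4-0476.

Proof (both, script of grounder-ground-B-0 / -A-0): a homotopy sphere is compact (structure field)
and simply connected (`hSC` applied to `S.nonempty_homotopyEquiv`), so the classification
hypothesis applies to the metric provided by the thesis.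
-/

open scoped Manifold ContDiff
open ContinuousMap

namespace Literature.SPC4

/-- Settles stmt-SmoothPoincare4-0474 (assembly of route PIC): Hamilton–Chen–Tang–Zhu (π₁ = 1) ∧
(≃ₕ S⁴ ⇒ simply connected) ∧ (PIC metrics on all homotopy 4-spheres) ⇒ every homotopy 4-sphere is
diffeomorphic to `S⁴`. [folklore] -/
theorem pic_assembly :
    (∀ (M : Type) [TopologicalSpace M] [T2Space M] [SecondCountableTopology M]
      [ChartedSpace (EuclideanSpace ℝ (Fin 4)) M] [IsManifold (𝓡 4) ∞ M] [CompactSpace M]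
      [SimplyConnectedSpace M],
      (∃ g : Literature.Geometry.Lorentzian.PseudoRiemannianMetric (𝓡 4) ∞ (EuclideanSpace ℝ (Fin 4))
          (TangentSpace (𝓡 4) : M → Type _), g.IsRiemannian ∧ g.HasPositiveIsotropicCurvature) →
        Nonempty (M ≃ₘ⟮𝓡 4, 𝓡 4⟯ Metric.sphere (0 : EuclideanSpace ℝ (Fin 5)) 1)) →
    (∀ (M : Type) [TopologicalSpace M],
      M ≃ₕ Metric.sphere (0 : EuclideanSpace ℝ (Fin 5)) 1 → SimplyConnectedSpace M) →
    (∀ S : Literature.Topology.FourManifolds.HomotopySphere 4,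
      ∃ g : Literature.Geometry.Lorentzian.PseudoRiemannianMetric (𝓡 4) ∞ (EuclideanSpace ℝ (Fin 4))
        (TangentSpace (𝓡 4) : S.carrier → Type _), g.IsRiemannian ∧ g.HasPositiveIsotropicCurvature) →
    ∀ S : Literature.Topology.FourManifolds.HomotopySphere 4,
      Nonempty (S.carrier ≃ₘ⟮𝓡 4, 𝓡 4⟯ Metric.sphere (0 : EuclideanSpace ℝ (Fin 5)) 1) := by
  intro hH hSC hX S
  obtain ⟨e⟩ := S.nonempty_homotopyEquiv
  haveI := hSC S.carrier e
  exact hH S.carrier (hX S)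

/-- Settles stmt-SmoothPoincare4-0477 (assembly of the flow-free branch of route PIC): Kuiper
(dim 4) ∧ (≃ₕ S⁴ ⇒ simply connected) ∧ (locally conformally flat metrics on all homotopy
4-spheres) ⇒ every homotopy 4-sphere is diffeomorphic to `S⁴`. [folklore] -/
theorem lcf_assembly :
    (∀ (M : Type) [TopologicalSpace M] [T2Space M] [SecondCountableTopology M]
      [ChartedSpace (EuclideanSpace ℝ (Fin 4)) M] [IsManifold (𝓡 4) ∞ M] [CompactSpace M]
      [SimplyConnectedSpace M],
      (∃ g : Literature.Geometry.Lorentzian.PseudoRiemannianMetric (𝓡 4) ∞ (EuclideanSpace ℝ (Fin 4))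
          (TangentSpace (𝓡 4) : M → Type _), g.IsRiemannian ∧ g.IsLocallyConformallyFlat) →
        Nonempty (M ≃ₘ⟮𝓡 4, 𝓡 4⟯ Metric.sphere (0 : EuclideanSpace ℝ (Fin 5)) 1)) →
    (∀ (M : Type) [TopologicalSpace M],
      M ≃ₕ Metric.sphere (0 : EuclideanSpace ℝ (Fin 5)) 1 → SimplyConnectedSpace M) →
    (∀ S : Literature.Topology.FourManifolds.HomotopySphere 4,
      ∃ g : Literature.Geometry.Lorentzian.PseudoRiemannianMetric (𝓡 4) ∞ (EuclideanSpace ℝ (Fin 4))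
        (TangentSpace (𝓡 4) : S.carrier → Type _), g.IsRiemannian ∧ g.IsLocallyConformallyFlat) →
    ∀ S : Literature.Topology.FourManifolds.HomotopySphere 4,
      Nonempty (S.carrier ≃ₘ⟮𝓡 4, 𝓡 4⟯ Metric.sphere (0 : EuclideanSpace ℝ (Fin 5)) 1) := by
  intro hK hSC hX S
  obtain ⟨e⟩ := S.nonempty_homotopyEquiv
  haveI := hSC S.carrier e
  exact hK S.carrier (hX S)

end Literature.SPC4
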